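import Literature.Probability.LatticeModels.FieldCurrentsClusters
import HarnessLib

/-!
# The third-order truncation `⟨σ_x; σ_B; σ_C⟩` and Aizenman–Fernández's Proposition 5.2

Topic `Probability/LatticeModels`, namespace `Literature.Probability.LatticeModels`. Layer of the
proof of the Aizenman–Fernández differential inequalities (J. Stat. Phys. 44 (1986) 393–454) in the
`θ`-systems of `FieldCurrentsTheta` / `FieldCurrentsClusters`:

* Part A. **Prop. 3.4, eq. (3.14), general form**: for `x ∈ Λ` and an even set `A ⊆ Λ`,
  `⟨σ_xσ_A⟩ - ⟨σ_x⟩⟨σ_A⟩ = Z⁻² ∑_{∂n₁ = ({x}∆A)*, ∂n₂ = ∅} w w 𝟙[x ↮ g]`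
  (`thetaCorr_symmDiff_sub_mul_eq_pairSum`).
* Part B. **Prop. 3.6 / Cor. 3.7, eqs. (3.17)–(3.19)**: the same quantity resolved according to
  the cluster of `x`: `∑_S ⟨σ_{A ∩ S}⟩_S · w_x(A ∖ S; S)`, the weights `clusterWeight'` generalising
  the pair weights of (3.15)–(3.16) to several sources inside the cluster
  (`thetaCorr_symmDiff_sub_mul_eq_sum`), and the third-order truncation
  `tripleTrunc θ x B C = ⟨σ_x; σ_B; σ_C⟩ = ⟨σ_xσ_Bσ_C⟩ - ⟨σ_xσ_B⟩⟨σ_C⟩ - ⟨σ_xσ_C⟩⟨σ_B⟩ - ⟨σ_x⟩⟨σ_Bσ_C⟩ + 2⟨σ_x⟩⟨σ_B⟩⟨σ_C⟩`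
  (the derivative of `⟨σ_x; σ_B⟩` in the coupling of `σ_C`).
* Part C. **Proposition 5.2, eq. (5.4)** (the "new correlation inequality"): for distinct
  `x, y, z, k, l`,
  `⟨σ_x; σ_yσ_z; σ_kσ_l⟩ ≤ 2 ∑ ⟨σ_x;σ_a⟩ ⟨σ_āσ_c⟩_{h=0} ⟨σ_c̄⟩`, the sum over the eight choices of an
  endpoint `a` of one bond (partner `ā`) and an endpoint `c` of the other (partner `c̄`) — the
  printed twelve terms of (5.6)–(5.10), each of this shape, grouped; and **(5.5)**:
  `⟨σ_x; σ_B; σ_B⟩ = -2⟨σ_B⟩⟨σ_x;σ_B⟩ ≤ 0`.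

Everything is proved; there are no named facts.

## References

* M. Aizenman, R. Fernández, J. Stat. Phys. 44 (1986) 393–454: §3.4 (Props. 3.4, 3.6, Cor. 3.5,
  3.7, eqs. (3.14)–(3.19)), §5.1 (Lemma 5.1, Prop. 5.2, eqs. (5.1)–(5.10))
  [AizenmanFernandezJSP1986] (held: `paper:url-b8cebc3f44bb`).
-/

noncomputable section

open Finset MeasureTheory
open scoped symmDiff ENNReal

namespace Literature.Probability.LatticeModels

variable {V : Type*} [DecidableEq V]

section Triple

variable {G : SimpleGraph V} [G.LocallyFinite] {Λ : Finset V}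

local notation "Gg" => ghostGraph G Λ
local notation "Λg" => Finset.insertNone Λ
local notation "Eg" => edgesIn (ghostGraph G Λ) (Finset.insertNone Λ)
local notation "Zg[" θ ", " X "]" =>
  gcurrentZ (ghostGraph G Λ) (Finset.insertNone Λ) θ (edgesIn (ghostGraph G Λ) (Finset.insertNone Λ)) X
local notation "ZIn[" θ ", " S ", " X "]" =>
  gcurrentZ (ghostGraph G Λ) (Finset.insertNone Λ) θ (edgesIn (ghostGraph G Λ) S) X
local notation "Conn[" m ", " u ", " v "]" =>
  CConn (ghostGraph G Λ) (Finset.insertNone Λ) m (edgesIn (ghostGraph G Λ) (Finset.insertNone Λ)) u v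
local notation "𝒮[" m ", " b "]" => clusterCompl (ghostGraph G Λ) (Finset.insertNone Λ) m b

/-! ## Part A. Proposition 3.4 for a general even set -/

omit [DecidableEq V] [G.LocallyFinite] in
/-- `A* = A ∪ {g}` (lifted) for `|A|` odd. [folklore] -/
theorem starSet_of_odd {A : Finset V} (h : ¬Even #A) : starSet A = Finset.insertNone A := by
  rw [starSet, if_neg h]

omit [G.LocallyFinite] in
/-- Adding a point toggles the ghost: `({x} ∆ A)* = A* ∆ {x*}` with `{x}* = {x, g}`, for `|A|` even. [folklore] -/
theorem starSet_singleton_symmDiff {A : Finset V} (hA : Even #A) (x : V) :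
    starSet ({x} ∆ A) = starSet A ∆ ({some x} ∆ {none} : Finset (Option V)) := by
  have hodd : ¬Even #({x} ∆ A) := by
    rw [Nat.not_even_iff_odd]
    by_cases hx : x ∈ A
    · have : {x} ∆ A = A.erase x := by
        ext v; simp only [mem_symmDiff, mem_singleton, mem_erase]
        constructor
        · rintro (⟨rfl, h⟩ | ⟨h1, h2⟩)
          · exact absurd hx h
          · exact ⟨h2, h1⟩
        · rintro ⟨h1, h2⟩; exact Or.inr ⟨h2, h1⟩
      rw [this, card_erase_of_mem hx]
      rcases hA with ⟨r, hr⟩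
      have hpos : 0 < #A := card_pos.2 ⟨x, hx⟩
      exact ⟨r - 1, by omega⟩
    · have : {x} ∆ A = insert x A := by
        ext v; simp only [mem_symmDiff, mem_singleton, mem_insert]
        constructor
        · rintro (⟨rfl, -⟩ | ⟨h1, -⟩)
          · exact Or.inl rfl
          · exact Or.inr h1
        · rintro (rfl | h1)
          · exact Or.inl ⟨rfl, hx⟩
          · exact Or.inr ⟨h1, fun h => hx (h ▸ h1)⟩
      rw [this, card_insert_of_notMem hx]
      exact Even.add_one hA
  rw [starSet_of_odd hodd, starSet_of_even hA]
  ext v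
  rcases v with _ | b
  · simp [Finset.mem_insertNone, mem_symmDiff]
  · simp only [Finset.some_mem_insertNone, mem_symmDiff, mem_singleton, mem_map, Function.Embedding.some_apply,
      Option.some.injEq, exists_eq_right, reduceCtorEq]
    tauto

/-- **Proposition 3.4, eq. (3.14), for a general even set of spins**: for `x ∈ Λ`, `A ⊆ Λ` with
`|A|` even and `θ ≥ 0`,
`⟨σ_{{x} ∆ A}⟩ - ⟨σ_x⟩⟨σ_A⟩ = Z⁻² ∑_{∂n₁ = ({x} ∆ A)*, ∂n₂ = ∅} w(n₁)w(n₂) 𝟙[x ↮ g]`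
(switching lemma on `Z(A*) Z({x}*)`). [cite: AizenmanFernandezJSP1986, §3.4, Prop. 3.4, eq. (3.14)] -/
theorem thetaCorr_symmDiff_sub_mul_eq_pairSum {θ : Sym2 (Option V) → ℝ} (hθ : ∀ e, 0 ≤ θ e) {x : V} (hx : x ∈ Λ)
    {A : Finset V} (hA : A ⊆ Λ) (hAe : Even #A) :
    thetaCorr G Λ θ ({x} ∆ A) - thetaCorr G Λ θ {x} * thetaCorr G Λ θ A =
      (currentPairSum G Λ θ (starSet ({x} ∆ A)) ∅ (fun m => ind (¬Conn[m, some x, none]))).toReal /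
        (Zg[θ, ∅]).toReal ^ 2 := by
  have hxA : ({x} ∆ A : Finset V) ⊆ Λ := symmDiff_le_sup.trans (sup_le (singleton_subset_iff.2 hx) hA)
  rw [thetaCorr_eq_gcurrentZ_div hθ hxA, thetaCorr_eq_gcurrentZ_div hθ (singleton_subset_iff.2 hx),
    thetaCorr_eq_gcurrentZ_div hθ hA]
  have hZpos : 0 < (Zg[θ, ∅]).toReal := toReal_gcurrentZ_ghost_empty_pos subset_rfl hθ subset_rfl
  set X := starSet ({x} ∆ A) with hX
  -- `Z(X) Z(∅) = ∑ 𝟙[x ↔ g] + ∑ 𝟙[x ↮ g]`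
  have h1 : Zg[θ, X] * Zg[θ, ∅] =
      currentPairSum G Λ θ X ∅ (fun m => ind Conn[m, some x, none]) +
        currentPairSum G Λ θ X ∅ (fun m => ind (¬Conn[m, some x, none])) := by
    rw [← currentPairSum_one, ← currentPairSum_add]
    refine currentPairSum_congr fun n₁ n₂ _ _ => ?_
    by_cases h : Conn[n₁ + n₂, some x, none]
    · rw [ind_of_true h, ind_of_false (not_not.2 h), add_zero]
    · rw [ind_of_false h, ind_of_true h, zero_add]
  -- `Z(A*) Z({x}*) = ∑ 𝟙[x ↔ g]` (switching)
  have h2 : Zg[θ, starSet A] * Zg[θ, starSet {x}] =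
      currentPairSum G Λ θ X ∅ (fun m => ind Conn[m, some x, none]) := by
    rw [← currentPairSum_one, starSet_singleton]
    conv_lhs => rw [show starSet A = X ∆ ({some x} ∆ {none}) by
      rw [hX, starSet_singleton_symmDiff hAe, symmDiff_assoc, symmDiff_self, symmDiff_bot]]
    rw [currentPairSum_switching hθ]
    exact currentPairSum_congr fun _ _ _ _ => by rw [one_mul]
  have hP1 : currentPairSum G Λ θ X ∅ (fun m => ind Conn[m, some x, none]) ≠ ∞ :=
    currentPairSum_ne_top hθ _ _ fun _ => ind_le_one _
  have hP2 : currentPairSum G Λ θ X ∅ (fun m => ind (¬Conn[m, some x, none])) ≠ ∞ :=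
    currentPairSum_ne_top hθ _ _ fun _ => ind_le_one _
  have h1' := congrArg ENNReal.toReal h1
  have h2' := congrArg ENNReal.toReal h2
  rw [ENNReal.toReal_mul, ENNReal.toReal_add hP1 hP2] at h1'
  rw [ENNReal.toReal_mul] at h2'
  field_simp
  linear_combination h1' - h2'

/-! ## Part B. Resolution according to the cluster of `x` (Prop. 3.6 / Cor. 3.7) -/

variable (G Λ) in
/-- **The cluster weights with several sources**: `clusterWeight' θ x Y S = Z⁻² ∑_{∂n₁ = Y*, ∂n₂ = ∅} w w 𝟙[𝒮_x = S]`
(`Y ∋ x` a set of real sources; for `Y = {x, a}` this is the `clusterWeight θ x a S` of (3.15)). [cite: AizenmanFernandezJSP1986, §3.4, Prop. 3.6, eq. (3.17)] -/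
def clusterWeight' (θ : Sym2 (Option V) → ℝ) (x : V) (Y : Finset V) (S : Finset (Option V)) : ℝ :=
  (currentPairSum G Λ θ (starSet Y) ∅ (fun m => ind (𝒮[m, some x] = S))).toReal / (Zg[θ, ∅]).toReal ^ 2

/-- `clusterWeight' ≥ 0`. [folklore] -/
theorem clusterWeight'_nonneg (θ : Sym2 (Option V) → ℝ) (x : V) (Y : Finset V) (S : Finset (Option V)) :
    0 ≤ clusterWeight' G Λ θ x Y S :=
  div_nonneg ENNReal.toReal_nonneg (pow_nonneg ENNReal.toReal_nonneg 2)

/-- The pair case: `clusterWeight' θ x ({x} ∆ {a}) = clusterWeight θ x a`. [folklore] -/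
theorem clusterWeight'_pair (θ : Sym2 (Option V) → ℝ) (x a : V) (S : Finset (Option V)) :
    clusterWeight' G Λ θ x ({x} ∆ {a}) S = clusterWeight G Λ θ x a S := rfl

/-- A high-temperature sum with an odd source set vanishes (handshake). [folklore] -/
theorem ghteSum_eq_zero_of_odd {θ : Sym2 (Option V) → ℝ} {E' : Finset (Sym2 (Option V))} (hE' : E' ⊆ Eg)
    {B : Finset (Option V)} (hB : ¬Even #B) : ghteSum Λg θ E' B = 0 := by
  unfold ghteSum
  refine sum_eq_zero fun F hF => ?_
  rw [mem_filter, mem_powerset] at hF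
  exact absurd (hF.2 ▸ even_card_oddVerts (hF.1.trans hE')) hB

/-- A current sum with an odd source set vanishes (handshake). [folklore] -/
theorem gcurrentZ_eq_zero_of_odd {θ : Sym2 (Option V) → ℝ} (hθ : ∀ e, 0 ≤ θ e) {E' : Finset (Sym2 (Option V))}
    (hE' : E' ⊆ Eg) {B : Finset (Option V)} (hB : ¬Even #B) :
    gcurrentZ Gg Λg θ E' B = 0 := by
  rw [gcurrentZ_eq_ofReal_ghteSum Gg Λg hθ hE', ghteSum_eq_zero_of_odd hE' hB, mul_zero, ENNReal.ofReal_zero]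

omit [G.LocallyFinite] in
/-- The real sources inside / outside `S`. [folklore] -/
theorem filter_some_mem_card_add {A : Finset V} (S : Finset (Option V)) :
    #(A.filter fun a => (some a : Option V) ∈ S) + #(A.filter fun a => (some a : Option V) ∉ S) = #A :=
  card_filter_add_card_filter_not _

/-- **Cor. 3.7-type resolution of `⟨σ_xσ_A⟩ - ⟨σ_x⟩⟨σ_A⟩` over the cluster of `x`**: for `x ∈ Λ`,
`A ⊆ Λ ∖ {x}` with `|A|` even and `θ ≥ 0`,
`⟨σ_{{x}∆A}⟩ - ⟨σ_x⟩⟨σ_A⟩ = ∑_{S ∋ g, S ∌ x} 𝟙[|A ∩ S| odd] ⟨σ_{A∩S}⟩_S · clusterWeight' x ({x} ∪ (A ∖ S)) S`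
(Lemma 3.3: on `𝒮_x = S` the currents inside `S` decouple and carry the sources `A ∩ S` and `g`;
the sources of the cluster are `x` and `A ∖ S`, an even number in all). [cite: AizenmanFernandezJSP1986, §3.4, Prop. 3.6 and Cor. 3.7, eqs. (3.17)–(3.19)] -/
theorem thetaCorr_symmDiff_sub_mul_eq_sum {θ : Sym2 (Option V) → ℝ} (hθ : ∀ e, 0 ≤ θ e) {x : V} (hx : x ∈ Λ)
    {A : Finset V} (hA : A ⊆ Λ) (hxA : x ∉ A) (hAe : Even #A) :
    thetaCorr G Λ θ ({x} ∆ A) - thetaCorr G Λ θ {x} * thetaCorr G Λ θ A =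
      ∑ S ∈ (Λg).powerset.filter (fun S => (none : Option V) ∈ S ∧ (some x : Option V) ∉ S),
        if Even #(A.filter fun a => (some a : Option V) ∈ S) then 0 else
          corrIn G Λ θ S (A.filter fun a => (some a : Option V) ∈ S) *
            clusterWeight' G Λ θ x (insert x (A.filter fun a => (some a : Option V) ∉ S)) S := by
  classical
  rw [thetaCorr_symmDiff_sub_mul_eq_pairSum hθ hx hA hAe]
  set X := starSet ({x} ∆ A) with hX
  set 𝒯 := (Λg).powerset.filter (fun S => (none : Option V) ∈ S ∧ (some x : Option V) ∉ S) with h𝒯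
  have hZpos : 0 < (Zg[θ, ∅]).toReal := toReal_gcurrentZ_ghost_empty_pos subset_rfl hθ subset_rfl
  -- `𝟙[x ↮ g] = 𝟙[𝒮_x ∈ 𝒯]`
  have hev : currentPairSum G Λ θ X ∅ (fun m => ind (¬Conn[m, some x, none])) =
      currentPairSum G Λ θ X ∅ (fun m => ind (𝒮[m, some x] ∈ 𝒯)) := by
    refine currentPairSum_congr fun n₁ n₂ _ _ => ?_
    congr 1
    refine propext ⟨fun h => ?_, fun h => ?_⟩
    · rw [h𝒯, mem_filter, mem_powerset]
      exact ⟨clusterCompl_subset _ _, mem_clusterCompl.2 ⟨Finset.none_mem_insertNone, h⟩,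
        not_mem_clusterCompl_self _ _⟩
    · rw [h𝒯, mem_filter] at h
      exact (mem_clusterCompl.1 h.2.1).2
  rw [hev, currentPairSum_ind_mem_eq_sum, ENNReal.toReal_sum (fun S _ => currentPairSum_ne_top hθ _ _ fun _ => ind_le_one _),
    sum_div]
  refine sum_congr rfl fun S hS => ?_
  rw [h𝒯, mem_filter, mem_powerset] at hS
  obtain ⟨hSΛ, hgS, hxS⟩ := hS
  have hb : (some x : Option V) ∈ Λg \ S := mem_sdiff.2 ⟨Finset.some_mem_insertNone.2 hx, hxS⟩
  set Ain := A.filter (fun a => (some a : Option V) ∈ S) with hAin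
  set Aout := A.filter (fun a => (some a : Option V) ∉ S) with hAout
  have hxA' : {x} ∆ A = insert x A := by
    ext v; simp only [mem_symmDiff, mem_singleton, mem_insert]
    constructor
    · rintro (⟨rfl, -⟩ | ⟨h1, -⟩)
      · exact Or.inl rfl
      · exact Or.inr h1
    · rintro (rfl | h1)
      · exact Or.inl ⟨rfl, hxA⟩
      · exact Or.inr ⟨h1, fun h => hxA (h ▸ h1)⟩
  have hodd : ¬Even #({x} ∆ A) := by
    rw [hxA', card_insert_of_notMem hxA, Nat.not_even_iff_odd]; exact Even.add_one hAe
  have hXeq : X = Finset.insertNone (insert x A) := by rw [hX, starSet_of_odd hodd, hxA']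
  -- the strip
  have hstrip := currentPairSum_clusterCompl_strip (G := G) θ hSΛ hb X ∅
  simp only [Finset.filter_empty] at hstrip
  have hXin : X.filter (· ∈ S) = Finset.insertNone Ain := by
    rw [hXeq]; ext v
    rcases v with _ | b
    · simp [Finset.mem_insertNone, hgS]
    · simp only [mem_filter, Finset.some_mem_insertNone, mem_insert, hAin]
      constructor
      · rintro ⟨rfl | hb', hbS⟩
        · exact absurd hbS hxS
        · exact ⟨hb', hbS⟩
      · rintro ⟨hb', hbS⟩; exact ⟨Or.inr hb', hbS⟩
  have hXout : X.filter (· ∉ S) = (insert x Aout).map Function.Embedding.some := by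
    rw [hXeq]; ext v
    rcases v with _ | b
    · simp [Finset.mem_insertNone, hgS]
    · simp only [mem_filter, Finset.some_mem_insertNone, mem_insert, mem_map, Function.Embedding.some_apply,
        Option.some.injEq, exists_eq_right, hAout]
      constructor
      · rintro ⟨rfl | hb', hbS⟩
        · exact Or.inl rfl
        · exact Or.inr ⟨hb', hbS⟩
      · rintro (rfl | ⟨hb', hbS⟩)
        · exact ⟨Or.inl rfl, hxS⟩
        · exact ⟨Or.inr hb', hbS⟩
  have hZS : 0 < (ZIn[θ, S, ∅]).toReal := toReal_gcurrentZ_in_pos hθ hSΛ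
  have hZS0 : ZIn[θ, S, ∅] ≠ 0 := fun h => by rw [h, ENNReal.toReal_zero] at hZS; exact lt_irrefl _ hZS
  by_cases hpar : Even #Ain
  · -- odd source set inside `S`: the term vanishes
    rw [if_pos hpar]
    have hoddin : ¬Even #(Finset.insertNone Ain) := by
      rw [Finset.card_insertNone, Nat.not_even_iff_odd]; exact Even.add_one hpar
    have h0 : ZIn[θ, S, X.filter (· ∈ S)] = 0 := by
      rw [hXin]; exact gcurrentZ_eq_zero_of_odd hθ (edgesIn_mono Gg hSΛ) hoddin
    rw [h0, zero_mul, zero_mul] at hstrip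
    have : currentPairSum G Λ θ X ∅ (fun m => ind (𝒮[m, some x] = S)) = 0 := by
      rcases mul_eq_zero.1 hstrip with h | h
      · exact h
      · exact absurd (mul_eq_zero.1 h |>.elim id id) hZS0
    rw [this, ENNReal.toReal_zero, zero_div]
  · rw [if_neg hpar]
    -- parities: `|Aout|` is odd as well, so `insert x Aout` is even
    have hparout : Even #(insert x Aout) := by
      have hxout : x ∉ Aout := fun h => hxA (mem_filter.1 h).1
      rw [card_insert_of_notMem hxout]
      have hsum := filter_some_mem_card_add (A := A) S
      rw [← hAin, ← hAout] at hsum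
      rw [Nat.not_even_iff_odd] at hpar
      rcases hpar with ⟨r, hr⟩
      rcases hAe with ⟨t, ht⟩
      exact ⟨(#Aout + 1) / 2, by omega⟩
    have hXin' : X.filter (· ∈ S) = starSet Ain := by rw [hXin, starSet_of_odd hpar]
    have hXout' : X.filter (· ∉ S) = starSet (insert x Aout) := by rw [hXout, starSet_of_even hparout]
    rw [hXin', hXout'] at hstrip
    -- divide the strip identity by `Z² Z_S(∅)²`
    have hAinΛ : Ain ⊆ Λ := (filter_subset _ _).trans hA
    rw [corrIn_eq_gcurrentZ_div hθ hSΛ hAinΛ, clusterWeight']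
    have h := congrArg ENNReal.toReal hstrip
    rw [ENNReal.toReal_mul, ENNReal.toReal_mul, ENNReal.toReal_mul, ENNReal.toReal_mul] at h
    field_simp
    nlinarith [h, hZS]

/-! ## Part C. Proposition 5.2 -/

/-- Over the retained regions `S ∋ g`, `S ∌ x`, the pair weights sum to the truncated pair
function: `∑_S clusterWeight x a S = ⟨σ_xσ_a⟩ - ⟨σ_x⟩⟨σ_a⟩` ((3.15); the weights vanish when
`x ∈ S`). [cite: AizenmanFernandezJSP1986, §3.4, Cor. 3.5, eq. (3.15)] -/
theorem sum_clusterWeight_filter_eq {θ : Sym2 (Option V) → ℝ} (hθ : ∀ e, 0 ≤ θ e) {x a : V} (hx : x ∈ Λ) (ha : a ∈ Λ) :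
    ∑ S ∈ (Λg).powerset.filter (fun S => (none : Option V) ∈ S ∧ (some x : Option V) ∉ S), clusterWeight G Λ θ x a S =
      thetaCorr G Λ θ ({x} ∆ {a}) - thetaCorr G Λ θ {x} * thetaCorr G Λ θ {a} := by
  rw [thetaCorr_pair_sub_eq_sum_clusterWeight hθ hx ha]
  refine sum_subset (fun S hS => ?_) fun S hS hS' => ?_
  · rw [mem_filter] at hS ⊢; exact ⟨hS.1, hS.2.1⟩
  · rw [mem_filter] at hS hS'
    have hxS : (some x : Option V) ∈ S := by
      by_contra h; exact hS' ⟨hS.1, hS.2, h⟩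
    exact clusterWeight_eq_zero_of_mem (Or.inl hxS)

/-- **The `A₂` bound, eq. (5.10)**: for distinct `x, p, q, r ∈ Λ`, the weight of the clusters of
`x` containing `p, q, r` (sources `{x, p, q, r}`) and avoiding the ghost is at most
`⟨σ_qσ_r⟩_{h=0} ⟨σ_x;σ_p⟩`: switch the pair `{q, r}` (joined through `x`), weaken `x ↔ q` to
`q ↮ g`, condition on the `h`-cluster (Lemma 5.1) and pull out `⟨σ_qσ_r⟩_{C^c} ≤ ⟨σ_qσ_r⟩_{h=0}`. [cite: AizenmanFernandezJSP1986, §5.1, proof of Prop. 5.2, eq. (5.10)] -/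
theorem sum_clusterWeight'_triple_le {θ : Sym2 (Option V) → ℝ} (hθ : ∀ e, 0 ≤ θ e) {x p q r : V}
    (hx : x ∈ Λ) (hp : p ∈ Λ) (hq : q ∈ Λ) (hr : r ∈ Λ)
    (hxp : x ≠ p) (hxq : x ≠ q) (hxr : x ≠ r) (hpq : p ≠ q) (hpr : p ≠ r) (hqr : q ≠ r) :
    ∑ S ∈ (Λg).powerset.filter (fun S => (none : Option V) ∈ S ∧ (some x : Option V) ∉ S ∧
        (some q : Option V) ∉ S ∧ (some r : Option V) ∉ S),
      clusterWeight' G Λ θ x (insert x (insert p ({q} ∆ {r}))) S ≤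
      thetaCorr G Λ (zeroField θ) ({q} ∆ {r}) *
        (thetaCorr G Λ θ ({x} ∆ {p}) - thetaCorr G Λ θ {x} * thetaCorr G Λ θ {p}) := by
  classical
  set 𝒯 := (Λg).powerset.filter (fun S => (none : Option V) ∈ S ∧ (some x : Option V) ∉ S ∧
      (some q : Option V) ∉ S ∧ (some r : Option V) ∉ S) with h𝒯
  have hZpos : 0 < (Zg[θ, ∅]).toReal := toReal_gcurrentZ_ghost_empty_pos subset_rfl hθ subset_rfl
  -- the source set and the switch
  have hqr_set : ({q} ∆ {r} : Finset V) = {q, r} := by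
    ext v; simp only [mem_symmDiff, mem_singleton, mem_insert]
    constructor
    · rintro (⟨rfl, -⟩ | ⟨rfl, -⟩)
      · exact Or.inl rfl
      · exact Or.inr rfl
    · rintro (rfl | rfl)
      · exact Or.inl ⟨rfl, hqr⟩
      · exact Or.inr ⟨rfl, fun h => hqr h.symm⟩
  set Y : Finset V := insert x (insert p ({q} ∆ {r})) with hY
  have hYcard : Even #Y := by
    rw [hY, hqr_set, card_insert_of_notMem, card_insert_of_notMem, card_pair hqr]
    · decide
    · simp [hpq, hpr]
    · simp [hxp, hxq, hxr]
  have hYstar : starSet Y = starSet ({x} ∆ {p}) ∆ ({some q} ∆ {some r}) := by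
    rw [starSet_of_even hYcard, starSet_pair, hY, hqr_set]
    ext v
    simp only [mem_map, Function.Embedding.some_apply, mem_insert, mem_singleton, mem_symmDiff]
    constructor
    · rintro ⟨w, hw, rfl⟩
      rcases hw with rfl | rfl | rfl | rfl
      · left; exact ⟨Or.inl ⟨rfl, fun h => hxp (Option.some_injective _ h)⟩,
          fun h => by rcases h with ⟨h1, -⟩ | ⟨h1, -⟩ <;> [exact hxq (Option.some_injective _ h1); exact hxr (Option.some_injective _ h1)]⟩
      · left; exact ⟨Or.inr ⟨rfl, fun h => hxp (Option.some_injective _ h).symm⟩,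
          fun h => by rcases h with ⟨h1, -⟩ | ⟨h1, -⟩ <;> [exact hpq (Option.some_injective _ h1); exact hpr (Option.some_injective _ h1)]⟩
      · right; exact ⟨Or.inl ⟨rfl, fun h => hqr (Option.some_injective _ h)⟩,
          fun h => by rcases h with ⟨h1, -⟩ | ⟨h1, -⟩ <;> [exact hxq (Option.some_injective _ h1).symm; exact hpq (Option.some_injective _ h1).symm]⟩
      · right; exact ⟨Or.inr ⟨rfl, fun h => hqr (Option.some_injective _ h).symm⟩,
          fun h => by rcases h with ⟨h1, -⟩ | ⟨h1, -⟩ <;> [exact hxr (Option.some_injective _ h1).symm; exact hpr (Option.some_injective _ h1).symm]⟩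
    · rintro (⟨h1, -⟩ | ⟨h1, -⟩)
      · rcases h1 with ⟨rfl, -⟩ | ⟨rfl, -⟩
        · exact ⟨x, Or.inl rfl, rfl⟩
        · exact ⟨p, Or.inr (Or.inl rfl), rfl⟩
      · rcases h1 with ⟨rfl, -⟩ | ⟨rfl, -⟩
        · exact ⟨q, Or.inr (Or.inr (Or.inl rfl)), rfl⟩
        · exact ⟨r, Or.inr (Or.inr (Or.inr rfl)), rfl⟩
  -- the sum as one pair sum, and the monotonicity of the event
  have hsum : ∑ S ∈ 𝒯, clusterWeight' G Λ θ x Y S =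
      (currentPairSum G Λ θ (starSet Y) ∅ (fun m => ind (𝒮[m, some x] ∈ 𝒯))).toReal / (Zg[θ, ∅]).toReal ^ 2 := by
    unfold clusterWeight'
    rw [← sum_div, ← ENNReal.toReal_sum (fun S _ => currentPairSum_ne_top hθ _ _ fun _ => ind_le_one _),
      ← currentPairSum_ind_mem_eq_sum]
  have hmono : currentPairSum G Λ θ (starSet Y) ∅ (fun m => ind (𝒮[m, some x] ∈ 𝒯)) ≤
      currentPairSum G Λ θ (starSet Y) ∅ (fun m => ind (¬Conn[m, some x, none] ∧ ¬Conn[m, some q, none]) *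
        ind (Conn[m, some q, some r])) := by
    refine currentPairSum_mono fun n₁ n₂ _ _ => ?_
    by_cases hev : 𝒮[n₁ + n₂, some x] ∈ 𝒯
    · rw [h𝒯, mem_filter] at hev
      obtain ⟨-, hgS, -, hqS, hrS⟩ := hev
      have hxg : ¬Conn[n₁ + n₂, some x, none] := (mem_clusterCompl.1 hgS).2
      have hxq' : Conn[n₁ + n₂, some x, some q] := by
        by_contra h; exact hqS (mem_clusterCompl.2 ⟨Finset.some_mem_insertNone.2 hq, h⟩)
      have hxr' : Conn[n₁ + n₂, some x, some r] := by
        by_contra h; exact hrS (mem_clusterCompl.2 ⟨Finset.some_mem_insertNone.2 hr, h⟩)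
      have hqg : ¬Conn[n₁ + n₂, some q, none] := fun h => hxg (hxq'.trans h)
      have hqr' : Conn[n₁ + n₂, some q, some r] := hxq'.symm.trans hxr'
      rw [ind_of_true (show 𝒮[n₁ + n₂, some x] ∈ 𝒯 from mem_filter.2 ⟨mem_powerset.2 (clusterCompl_subset _ _),
        hgS, not_mem_clusterCompl_self _ _, hqS, hrS⟩), ind_of_true ⟨hxg, hqg⟩, ind_of_true hqr', one_mul]
    · rw [ind_of_false hev]; exact bot_le
  -- switching the pair `{q, r}` and conditioning on the `h`-cluster
  have hsw : currentPairSum G Λ θ (starSet Y) ∅ (fun m => ind (¬Conn[m, some x, none] ∧ ¬Conn[m, some q, none]) *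
        ind (Conn[m, some q, some r])) =
      currentPairSum G Λ θ (starSet ({x} ∆ {p})) (starSet ({q} ∆ {r}))
        (fun m => ind (¬Conn[m, some x, none] ∧ ¬Conn[m, some q, none])) := by
    have h := currentPairSum_switching hθ (starSet Y) (some q) (some r)
      (fun m => ind (¬Conn[m, some x, none] ∧ ¬Conn[m, some q, none]))
    rw [show starSet Y ∆ ({some q} ∆ {some r}) = starSet ({x} ∆ {p}) by
      rw [hYstar, symmDiff_assoc, symmDiff_self, symmDiff_bot]] at h
    rw [starSet_pair q r]
    exact h.symm
  have hfin : currentPairSum G Λ θ (starSet ({x} ∆ {p})) (starSet ({q} ∆ {r}))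
      (fun m => ind (¬Conn[m, some x, none] ∧ ¬Conn[m, some q, none])) ≠ ∞ :=
    currentPairSum_ne_top hθ _ _ fun _ => ind_le_one _
  have hle : ∑ S ∈ 𝒯, clusterWeight' G Λ θ x Y S ≤
      (currentPairSum G Λ θ (starSet ({x} ∆ {p})) (starSet ({q} ∆ {r}))
        (fun m => ind (¬Conn[m, some x, none] ∧ ¬Conn[m, some q, none]))).toReal / (Zg[θ, ∅]).toReal ^ 2 := by
    rw [hsum, ← hsw]
    exact div_le_div_of_nonneg_right (ENNReal.toReal_mono (hsw ▸ hfin) hmono) (pow_nonneg hZpos.le 2)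
  rw [pairSum_hcluster_eq_sum hθ hx hp hq hr] at hle
  refine hle.trans ?_
  -- pull out `⟨σ_qσ_r⟩_{S',0} ≤ ⟨σ_qσ_r⟩_{h=0}` and use (5.3)
  have hxp' : ({x} ∆ {p} : Finset V) ⊆ Λ :=
    symmDiff_le_sup.trans (sup_le (singleton_subset_iff.2 hx) (singleton_subset_iff.2 hp))
  have hqr'' : ({q} ∆ {r} : Finset V) ⊆ Λ :=
    symmDiff_le_sup.trans (sup_le (singleton_subset_iff.2 hq) (singleton_subset_iff.2 hr))
  calc ∑ S' ∈ Λ.powerset.filter (fun S' => x ∈ S' ∧ p ∈ S' ∧ q ∈ S' ∧ r ∈ S'),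
        hclusterWeight G Λ θ S' * (corrIn G Λ θ (S'.map Function.Embedding.some) ({x} ∆ {p}) *
          corrIn G Λ θ (S'.map Function.Embedding.some) ({q} ∆ {r}))
      ≤ ∑ S' ∈ Λ.powerset.filter (fun S' => x ∈ S' ∧ p ∈ S' ∧ q ∈ S' ∧ r ∈ S'),
          thetaCorr G Λ (zeroField θ) ({q} ∆ {r}) *
            (hclusterWeight G Λ θ S' * corrIn G Λ θ (S'.map Function.Embedding.some) ({x} ∆ {p})) := by
        refine sum_le_sum fun S' _ => ?_
        have h1 := corrIn_map_le_zeroField (G := G) (Λ := Λ) hθ S' hqr'' (θ := θ)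
        have h2 : 0 ≤ hclusterWeight G Λ θ S' * corrIn G Λ θ (S'.map Function.Embedding.some) ({x} ∆ {p}) :=
          mul_nonneg (hclusterWeight_nonneg θ S') (corrIn_nonneg hθ _ hxp')
        nlinarith [h1, h2]
    _ = thetaCorr G Λ (zeroField θ) ({q} ∆ {r}) *
          ∑ S' ∈ Λ.powerset.filter (fun S' => x ∈ S' ∧ p ∈ S' ∧ q ∈ S' ∧ r ∈ S'),
            hclusterWeight G Λ θ S' * corrIn G Λ θ (S'.map Function.Embedding.some) ({x} ∆ {p}) := by
        rw [mul_sum]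
    _ ≤ thetaCorr G Λ (zeroField θ) ({q} ∆ {r}) *
          ∑ S' ∈ Λ.powerset.filter (fun S' => x ∈ S' ∧ p ∈ S'),
            hclusterWeight G Λ θ S' * corrIn G Λ θ (S'.map Function.Embedding.some) ({x} ∆ {p}) := by
        refine mul_le_mul_of_nonneg_left ?_ (thetaCorr_nonneg (zeroField_nonneg hθ) hqr'')
        refine sum_le_sum_of_subset_of_nonneg (fun S' hS' => ?_) fun S' _ _ =>
          mul_nonneg (hclusterWeight_nonneg θ S') (corrIn_nonneg hθ _ hxp')
        rw [mem_filter] at hS' ⊢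
        exact ⟨hS'.1, hS'.2.1, hS'.2.2.1⟩
    _ = _ := by rw [sum_hclusterWeight_mul_corrIn_pair hθ hx hp]

/-- `zeroField` of switched-off couplings is dominated by `zeroField`. [folklore] -/
theorem zeroField_cplOff_le {θ : Sym2 (Option V) → ℝ} (hθ : ∀ e, 0 ≤ θ e) (D : Finset (Sym2 (Option V))) :
    ∀ e, zeroField (cplOff θ D) e ≤ zeroField θ e := by
  intro e
  unfold zeroField
  split_ifs
  · exact le_rfl
  · exact cplOff_le hθ D e

/-- **The `A₁` bound, eqs. (5.7)–(5.8)**: in the region `S ∋ g`, for distinct `k, l` and any `z`,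
`⟨σ_zσ_kσ_l⟩_S - ⟨σ_kσ_l⟩⟨σ_z⟩_S ≤ ⟨σ_z; σ_kσ_l⟩_S ≤ ⟨σ_l⟩ ⟨σ_zσ_k⟩_{h=0} + ⟨σ_k⟩ ⟨σ_zσ_l⟩_{h=0}`
(Griffiths II twice, (3.16) and (3.15) in the depleted system, the domination of the truncated
pair function by the zero-field one, and monotonicity in the couplings). [cite: AizenmanFernandezJSP1986, §5.1, proof of Prop. 5.2, eqs. (5.7)–(5.9)] -/
theorem corrIn_triple_sub_mul_le {θ : Sym2 (Option V) → ℝ} (hθ : ∀ e, 0 ≤ θ e) (S : Finset (Option V))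
    {z k l : V} (hz : z ∈ Λ) (hk : k ∈ Λ) (hl : l ∈ Λ) (hkl : k ≠ l) :
    corrIn G Λ θ S ({z} ∆ ({k} ∆ {l})) - thetaCorr G Λ θ ({k} ∆ {l}) * corrIn G Λ θ S {z} ≤
      thetaCorr G Λ θ {l} * thetaCorr G Λ (zeroField θ) ({z} ∆ {k}) +
        thetaCorr G Λ θ {k} * thetaCorr G Λ (zeroField θ) ({z} ∆ {l}) := by
  set θS := cplOff θ (Eg \ edgesIn Gg S) with hθS
  have hθS0 : ∀ e, 0 ≤ θS e := cplOff_nonneg hθ _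
  have hkl' : ({k} ∆ {l} : Finset V) ⊆ Λ :=
    symmDiff_le_sup.trans (sup_le (singleton_subset_iff.2 hk) (singleton_subset_iff.2 hl))
  have hzk : ({z} ∆ {k} : Finset V) ⊆ Λ :=
    symmDiff_le_sup.trans (sup_le (singleton_subset_iff.2 hz) (singleton_subset_iff.2 hk))
  have hzl : ({z} ∆ {l} : Finset V) ⊆ Λ :=
    symmDiff_le_sup.trans (sup_le (singleton_subset_iff.2 hz) (singleton_subset_iff.2 hl))
  change thetaCorr G Λ θS ({z} ∆ ({k} ∆ {l})) - thetaCorr G Λ θ ({k} ∆ {l}) * thetaCorr G Λ θS {z} ≤ _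
  -- Griffiths II: `⟨σ_kσ_l⟩ ≥ ⟨σ_kσ_l⟩_S`
  have h1 : thetaCorr G Λ θS ({z} ∆ ({k} ∆ {l})) - thetaCorr G Λ θ ({k} ∆ {l}) * thetaCorr G Λ θS {z} ≤
      thetaCorr G Λ θS ({z} ∆ ({k} ∆ {l})) - thetaCorr G Λ θS {z} * thetaCorr G Λ θS ({k} ∆ {l}) := by
    have := thetaCorr_cplOff_le (G := G) hθ (Eg \ edgesIn Gg S) hkl'
    rw [← hθS] at this
    nlinarith [this, thetaCorr_nonneg (G := G) hθS0 (singleton_subset_iff.2 hz)]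
  refine h1.trans ?_
  -- (3.16) in the depleted system
  rw [thetaCorr_triple_sub_eq_sum hθS0 hz hk hl hkl]
  have hA : ∀ {a b : V}, b ∈ Λ →
      ∑ S' ∈ (Λg).powerset.filter (Claim1Side z a b), corrIn G Λ θS S' {b} * clusterWeight G Λ θS z a S' ≤
        thetaCorr G Λ θ {b} * ∑ S' ∈ (Λg).powerset.filter (fun S' => (none : Option V) ∈ S'), clusterWeight G Λ θS z a S' := by
    intro a b hb
    rw [mul_sum]
    calc ∑ S' ∈ (Λg).powerset.filter (Claim1Side z a b), corrIn G Λ θS S' {b} * clusterWeight G Λ θS z a S'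
        ≤ ∑ S' ∈ (Λg).powerset.filter (Claim1Side z a b), thetaCorr G Λ θ {b} * clusterWeight G Λ θS z a S' := by
          refine sum_le_sum fun S' _ => mul_le_mul_of_nonneg_right ?_ (clusterWeight_nonneg θS z a S')
          exact (corrIn_le_thetaCorr hθS0 S' (singleton_subset_iff.2 hb)).trans
            (by rw [hθS]; exact thetaCorr_cplOff_le hθ _ (singleton_subset_iff.2 hb))
      _ ≤ ∑ S' ∈ (Λg).powerset.filter (fun S' => (none : Option V) ∈ S'), thetaCorr G Λ θ {b} * clusterWeight G Λ θS z a S' := by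
          refine sum_le_sum_of_subset_of_nonneg (fun S' hS' => ?_) fun S' _ _ =>
            mul_nonneg (thetaCorr_nonneg hθ (singleton_subset_iff.2 hb)) (clusterWeight_nonneg θS z a S')
          rw [mem_filter] at hS' ⊢
          exact ⟨hS'.1, hS'.2.1⟩
  have hB : ∀ {a : V}, a ∈ Λ → ({z} ∆ {a} : Finset V) ⊆ Λ →
      ∑ S' ∈ (Λg).powerset.filter (fun S' => (none : Option V) ∈ S'), clusterWeight G Λ θS z a S' ≤
        thetaCorr G Λ (zeroField θ) ({z} ∆ {a}) := by
    intro a ha hza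
    rw [← thetaCorr_pair_sub_eq_sum_clusterWeight hθS0 hz ha]
    exact (thetaCorr_pair_sub_mul_le_zeroField hθS0 hz ha).trans
      (thetaCorr_mono (zeroField_nonneg hθS0) (zeroField_cplOff_le hθ _) hza)
  have hml : 0 ≤ thetaCorr G Λ θ {l} := thetaCorr_nonneg hθ (singleton_subset_iff.2 hl)
  have hmk : 0 ≤ thetaCorr G Λ θ {k} := thetaCorr_nonneg hθ (singleton_subset_iff.2 hk)
  calc _ ≤ thetaCorr G Λ θ {l} * ∑ S' ∈ (Λg).powerset.filter (fun S' => (none : Option V) ∈ S'), clusterWeight G Λ θS z k S' +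
        thetaCorr G Λ θ {k} * ∑ S' ∈ (Λg).powerset.filter (fun S' => (none : Option V) ∈ S'), clusterWeight G Λ θS z l S' :=
        add_le_add (hA hl) (hA hk)
    _ ≤ _ := add_le_add (mul_le_mul_of_nonneg_left (hB hk hzk) hml) (mul_le_mul_of_nonneg_left (hB hl hzl) hmk)

variable (G Λ) in
/-- **The third-order truncation** `⟨σ_x; σ_B; σ_C⟩ = ⟨σ_xσ_Bσ_C⟩ - ⟨σ_xσ_B⟩⟨σ_C⟩ - ⟨σ_xσ_C⟩⟨σ_B⟩ - ⟨σ_x⟩⟨σ_Bσ_C⟩ + 2⟨σ_x⟩⟨σ_B⟩⟨σ_C⟩`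
(products of spins as symmetric differences of index sets), the second derivative
`∂²⟨σ_x⟩/∂J_B∂J_C` (Aizenman–Fernández's `⟨σ_x; σ_yσ_z; σ_kσ_l⟩` for bonds `B = {y,z}`, `C = {k,l}`). [cite: AizenmanFernandezJSP1986, §5.1, Prop. 5.2 (the truncation in (5.4))] -/
def tripleTrunc (θ : Sym2 (Option V) → ℝ) (x : V) (B C : Finset V) : ℝ :=
  thetaCorr G Λ θ ({x} ∆ (B ∆ C)) - thetaCorr G Λ θ ({x} ∆ B) * thetaCorr G Λ θ C -
    thetaCorr G Λ θ ({x} ∆ C) * thetaCorr G Λ θ B - thetaCorr G Λ θ {x} * thetaCorr G Λ θ (B ∆ C) +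
    2 * thetaCorr G Λ θ {x} * thetaCorr G Λ θ B * thetaCorr G Λ θ C

/-- **Eq. (5.5)**: for coincident bonds, `⟨σ_x; σ_B; σ_B⟩ = -2⟨σ_B⟩ (⟨σ_xσ_B⟩ - ⟨σ_x⟩⟨σ_B⟩) ≤ 0`
(Griffiths II). [cite: AizenmanFernandezJSP1986, §5.1, Prop. 5.2, eq. (5.5)] -/
theorem tripleTrunc_self_le {θ : Sym2 (Option V) → ℝ} (hθ : ∀ e, 0 ≤ θ e) {x : V} (hx : x ∈ Λ) {B : Finset V}
    (hB : B ⊆ Λ) : tripleTrunc G Λ θ x B B ≤ 0 := by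
  unfold tripleTrunc
  rw [symmDiff_self, symmDiff_bot, Finset.bot_eq_empty, thetaCorr_empty, mul_one]
  have hxB : ({x} ∆ B : Finset V) ⊆ Λ := symmDiff_le_sup.trans (sup_le (singleton_subset_iff.2 hx) hB)
  have h1 : thetaCorr G Λ θ {x} * thetaCorr G Λ θ B ≤ thetaCorr G Λ θ ({x} ∆ B) :=
    thetaCorr_mul_le_symmDiff hθ (singleton_subset_iff.2 hx) hB
  have h2 : 0 ≤ thetaCorr G Λ θ B := thetaCorr_nonneg hθ hB
  nlinarith [h1, h2]

set_option maxHeartbeats 1600000 in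
set_option linter.unusedSimpArgs false in
/-- **Aizenman–Fernández 1986, Proposition 5.2, eq. (5.4)** ("a new correlation inequality which is
derived using the random current representation"): for distinct `x, y, z, k, l ∈ Λ` and `θ ≥ 0`,
`⟨σ_x; σ_yσ_z; σ_kσ_l⟩ ≤ 2 ∑ ⟨σ_x;σ_a⟩ ⟨σ_āσ_c⟩_{h=0} ⟨σ_c̄⟩`, the sum over the endpoints `a` of one
bond (partner `ā`) and `c` of the other (partner `c̄`) — eight products; the printed right side of
(5.4) consists of twelve terms of this shape (the `A₁` terms (5.9) and the `A₂` terms (5.10) of the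
decomposition (5.6) = (3.19)), each appearing here at most twice. Proof as printed: resolve the
three truncations `⟨σ_xσ_A⟩ - ⟨σ_x⟩⟨σ_A⟩` (`A = {y,z,k,l}, {y,z}, {k,l}`) over the cluster of `x`
(Cor. 3.7) and bound cluster by cluster with (5.7)–(5.10). [cite: AizenmanFernandezJSP1986, §5.1, Prop. 5.2, eqs. (5.4), (5.6)–(5.10)] -/
theorem tripleTrunc_le {θ : Sym2 (Option V) → ℝ} (hθ : ∀ e, 0 ≤ θ e) {x y z k l : V}
    (hx : x ∈ Λ) (hy : y ∈ Λ) (hz : z ∈ Λ) (hk : k ∈ Λ) (hl : l ∈ Λ)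
    (hxy : x ≠ y) (hxz : x ≠ z) (hxk : x ≠ k) (hxl : x ≠ l) (hyz : y ≠ z) (hyk : y ≠ k) (hyl : y ≠ l)
    (hzk : z ≠ k) (hzl : z ≠ l) (hkl : k ≠ l) :
    tripleTrunc G Λ θ x ({y} ∆ {z}) ({k} ∆ {l}) ≤
      2 * ((thetaCorr G Λ θ ({x} ∆ {y}) - thetaCorr G Λ θ {x} * thetaCorr G Λ θ {y}) * (thetaCorr G Λ (zeroField θ) ({z} ∆ {k}) * thetaCorr G Λ θ {l} + thetaCorr G Λ (zeroField θ) ({z} ∆ {l}) * thetaCorr G Λ θ {k}) +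
        (thetaCorr G Λ θ ({x} ∆ {z}) - thetaCorr G Λ θ {x} * thetaCorr G Λ θ {z}) * (thetaCorr G Λ (zeroField θ) ({y} ∆ {k}) * thetaCorr G Λ θ {l} + thetaCorr G Λ (zeroField θ) ({y} ∆ {l}) * thetaCorr G Λ θ {k}) +
        (thetaCorr G Λ θ ({x} ∆ {k}) - thetaCorr G Λ θ {x} * thetaCorr G Λ θ {k}) * (thetaCorr G Λ (zeroField θ) ({l} ∆ {y}) * thetaCorr G Λ θ {z} + thetaCorr G Λ (zeroField θ) ({l} ∆ {z}) * thetaCorr G Λ θ {y}) +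
        (thetaCorr G Λ θ ({x} ∆ {l}) - thetaCorr G Λ θ {x} * thetaCorr G Λ θ {l}) * (thetaCorr G Λ (zeroField θ) ({k} ∆ {y}) * thetaCorr G Λ θ {z} + thetaCorr G Λ (zeroField θ) ({k} ∆ {z}) * thetaCorr G Λ θ {y})) := by
  classical
  -- the index sets in insert form
  have pair : ∀ {a b : V}, a ≠ b → ({a} ∆ {b} : Finset V) = {a, b} := fun {a b} hab => by
    ext v; simp only [mem_symmDiff, mem_singleton, mem_insert]; constructor
    · rintro (⟨rfl, -⟩ | ⟨rfl, -⟩) <;> simp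
    · rintro (rfl | rfl)
      · exact Or.inl ⟨rfl, hab⟩
      · exact Or.inr ⟨rfl, fun h => hab h.symm⟩
  have hB : ({y} ∆ {z} : Finset V) = {y, z} := pair hyz
  have hC : ({k} ∆ {l} : Finset V) = {k, l} := pair hkl
  have hA : (({y} ∆ {z}) ∆ ({k} ∆ {l}) : Finset V) = {y, z, k, l} := by
    rw [hB, hC]; ext v
    simp only [mem_symmDiff, mem_insert, mem_singleton]
    constructor
    · rintro (⟨h, -⟩ | ⟨h, -⟩) <;> rcases h with rfl | rfl <;> simp
    · rintro (rfl | rfl | rfl | rfl)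
      · exact Or.inl ⟨Or.inl rfl, by rintro (h | h) <;> [exact hyk h; exact hyl h]⟩
      · exact Or.inl ⟨Or.inr rfl, by rintro (h | h) <;> [exact hzk h; exact hzl h]⟩
      · exact Or.inr ⟨Or.inl rfl, by rintro (h | h) <;> [exact hyk h.symm; exact hzk h.symm]⟩
      · exact Or.inr ⟨Or.inr rfl, by rintro (h | h) <;> [exact hyl h.symm; exact hzl h.symm]⟩
  have htt : tripleTrunc G Λ θ x ({y} ∆ {z}) ({k} ∆ {l}) =
      (thetaCorr G Λ θ ({x} ∆ {y, z, k, l}) - thetaCorr G Λ θ {x} * thetaCorr G Λ θ {y, z, k, l}) -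
        thetaCorr G Λ θ {k, l} * (thetaCorr G Λ θ ({x} ∆ {y, z}) - thetaCorr G Λ θ {x} * thetaCorr G Λ θ {y, z}) -
        thetaCorr G Λ θ {y, z} * (thetaCorr G Λ θ ({x} ∆ {k, l}) - thetaCorr G Λ θ {x} * thetaCorr G Λ θ {k, l}) := by
    unfold tripleTrunc; rw [hA, hB, hC]; ring
  have hAΛ : ({y, z, k, l} : Finset V) ⊆ Λ := by
    intro v hv; simp only [mem_insert, mem_singleton] at hv
    rcases hv with rfl | rfl | rfl | rfl <;> assumption
  have hBΛ : ({y, z} : Finset V) ⊆ Λ := by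
    intro v hv; simp only [mem_insert, mem_singleton] at hv
    rcases hv with rfl | rfl <;> assumption
  have hCΛ : ({k, l} : Finset V) ⊆ Λ := by
    intro v hv; simp only [mem_insert, mem_singleton] at hv
    rcases hv with rfl | rfl <;> assumption
  have hxA : x ∉ ({y, z, k, l} : Finset V) := by simp [hxy, hxz, hxk, hxl]
  have hxB : x ∉ ({y, z} : Finset V) := by simp [hxy, hxz]
  have hxC : x ∉ ({k, l} : Finset V) := by simp [hxk, hxl]
  have hAe : Even #({y, z, k, l} : Finset V) := by
    rw [card_insert_of_notMem (by simp [hyz, hyk, hyl]), card_insert_of_notMem (by simp [hzk, hzl]), card_pair hkl]; decide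
  have hBe : Even #({y, z} : Finset V) := by rw [card_pair hyz]; decide
  have hCe : Even #({k, l} : Finset V) := by rw [card_pair hkl]; decide
  rw [htt, thetaCorr_symmDiff_sub_mul_eq_sum hθ hx hAΛ hxA hAe, thetaCorr_symmDiff_sub_mul_eq_sum hθ hx hBΛ hxB hBe,
    thetaCorr_symmDiff_sub_mul_eq_sum hθ hx hCΛ hxC hCe, mul_sum, mul_sum, ← sum_sub_distrib, ← sum_sub_distrib]
  set 𝒯 := (Λg).powerset.filter (fun S => (none : Option V) ∈ S ∧ (some x : Option V) ∉ S) with h𝒯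
  -- nonnegativity of the constants
  have hm : ∀ {a : V}, a ∈ Λ → 0 ≤ thetaCorr G Λ θ {a} := fun {a} ha => thetaCorr_nonneg hθ (singleton_subset_iff.2 ha)
  have hG : ∀ {p q : V}, p ∈ Λ → q ∈ Λ → 0 ≤ thetaCorr G Λ (zeroField θ) ({p} ∆ {q}) := fun {p q} hp hq =>
    thetaCorr_nonneg (zeroField_nonneg hθ) (symmDiff_le_sup.trans (sup_le (singleton_subset_iff.2 hp) (singleton_subset_iff.2 hq)))
  have hBnn : 0 ≤ thetaCorr G Λ θ {y, z} := thetaCorr_nonneg hθ hBΛ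
  have hCnn : 0 ≤ thetaCorr G Λ θ {k, l} := thetaCorr_nonneg hθ hCΛ
  -- the pointwise bound, cluster by cluster
  have hpt : ∀ S ∈ 𝒯,
      (if Even #(({y, z, k, l} : Finset V).filter fun a => (some a : Option V) ∈ S) then 0 else
          corrIn G Λ θ S (({y, z, k, l} : Finset V).filter fun a => (some a : Option V) ∈ S) *
            clusterWeight' G Λ θ x (insert x (({y, z, k, l} : Finset V).filter fun a => (some a : Option V) ∉ S)) S) -
      thetaCorr G Λ θ {k, l} * (if Even #(({y, z} : Finset V).filter fun a => (some a : Option V) ∈ S) then 0 else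
          corrIn G Λ θ S (({y, z} : Finset V).filter fun a => (some a : Option V) ∈ S) *
            clusterWeight' G Λ θ x (insert x (({y, z} : Finset V).filter fun a => (some a : Option V) ∉ S)) S) -
      thetaCorr G Λ θ {y, z} * (if Even #(({k, l} : Finset V).filter fun a => (some a : Option V) ∈ S) then 0 else
          corrIn G Λ θ S (({k, l} : Finset V).filter fun a => (some a : Option V) ∈ S) *
            clusterWeight' G Λ θ x (insert x (({k, l} : Finset V).filter fun a => (some a : Option V) ∉ S)) S) ≤
      clusterWeight' G Λ θ x ({x, y} : Finset V) S * (thetaCorr G Λ θ {l} * thetaCorr G Λ (zeroField θ) ({z} ∆ {k}) + thetaCorr G Λ θ {k} * thetaCorr G Λ (zeroField θ) ({z} ∆ {l})) +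
        clusterWeight' G Λ θ x ({x, z} : Finset V) S * (thetaCorr G Λ θ {l} * thetaCorr G Λ (zeroField θ) ({y} ∆ {k}) + thetaCorr G Λ θ {k} * thetaCorr G Λ (zeroField θ) ({y} ∆ {l})) +
        clusterWeight' G Λ θ x ({x, k} : Finset V) S * (thetaCorr G Λ θ {z} * thetaCorr G Λ (zeroField θ) ({l} ∆ {y}) + thetaCorr G Λ θ {y} * thetaCorr G Λ (zeroField θ) ({l} ∆ {z})) +
        clusterWeight' G Λ θ x ({x, l} : Finset V) S * (thetaCorr G Λ θ {z} * thetaCorr G Λ (zeroField θ) ({k} ∆ {y}) + thetaCorr G Λ θ {y} * thetaCorr G Λ (zeroField θ) ({k} ∆ {z})) +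
        (if (some l : Option V) ∈ S ∧ (some y : Option V) ∉ S ∧ (some z : Option V) ∉ S ∧ (some k : Option V) ∉ S then thetaCorr G Λ θ {l} * clusterWeight' G Λ θ x ({x, y, z, k} : Finset V) S else 0) +
        (if (some k : Option V) ∈ S ∧ (some y : Option V) ∉ S ∧ (some z : Option V) ∉ S ∧ (some l : Option V) ∉ S then thetaCorr G Λ θ {k} * clusterWeight' G Λ θ x ({x, y, z, l} : Finset V) S else 0) +
        (if (some z : Option V) ∈ S ∧ (some y : Option V) ∉ S ∧ (some k : Option V) ∉ S ∧ (some l : Option V) ∉ S then thetaCorr G Λ θ {z} * clusterWeight' G Λ θ x ({x, y, k, l} : Finset V) S else 0) +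
        (if (some y : Option V) ∈ S ∧ (some z : Option V) ∉ S ∧ (some k : Option V) ∉ S ∧ (some l : Option V) ∉ S then thetaCorr G Λ θ {y} * clusterWeight' G Λ θ x ({x, z, k, l} : Finset V) S else 0) := by
    intro S hS
    rw [h𝒯, mem_filter, mem_powerset] at hS
    obtain ⟨hSΛ, hgS, hxS⟩ := hS
    -- the four `A₁` facts (5.7)–(5.9) and the bounds `⟨σ_d⟩_S ≤ ⟨σ_d⟩`
    have set3 : ∀ {a b d : V}, a ≠ b → a ≠ d → b ≠ d → ({a} ∆ ({b} ∆ {d}) : Finset V) = {a, b, d} := by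
      intro a b d hab had hbd
      rw [pair hbd]; ext v; simp only [mem_symmDiff, mem_singleton, mem_insert]
      constructor
      · rintro (⟨rfl, -⟩ | ⟨h, -⟩)
        · exact Or.inl rfl
        · exact Or.inr h
      · rintro (rfl | h)
        · exact Or.inl ⟨rfl, by rintro (h | h) <;> [exact hab h; exact had h]⟩
        · refine Or.inr ⟨h, ?_⟩; rintro rfl; rcases h with h | h <;> [exact hab h; exact had h]
    have Fy := corrIn_triple_sub_mul_le (G := G) (Λ := Λ) hθ S hz hk hl hkl (θ := θ)
    rw [set3 hzk hzl hkl, hC] at Fy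
    have Fz := corrIn_triple_sub_mul_le (G := G) (Λ := Λ) hθ S hy hk hl hkl (θ := θ)
    rw [set3 hyk hyl hkl, hC] at Fz
    have Fk := corrIn_triple_sub_mul_le (G := G) (Λ := Λ) hθ S hl hy hz hyz (θ := θ)
    rw [show ({l} ∆ ({y} ∆ {z}) : Finset V) = {y, z, l} by
      rw [set3 hyl.symm hzl.symm hyz]; ext v; simp only [mem_insert, mem_singleton]; tauto, hB] at Fk
    have Fl := corrIn_triple_sub_mul_le (G := G) (Λ := Λ) hθ S hk hy hz hyz (θ := θ)
    rw [show ({k} ∆ ({y} ∆ {z}) : Finset V) = {y, z, k} by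
      rw [set3 hyk.symm hzk.symm hyz]; ext v; simp only [mem_insert, mem_singleton]; tauto, hB] at Fl
    have hcor : ∀ {a : V}, a ∈ Λ → corrIn G Λ θ S {a} ≤ thetaCorr G Λ θ {a} := fun {a} ha =>
      corrIn_le_thetaCorr hθ S (singleton_subset_iff.2 ha)
    have hcor0 : ∀ {a : V}, a ∈ Λ → 0 ≤ corrIn G Λ θ S {a} := fun {a} ha => corrIn_nonneg hθ S (singleton_subset_iff.2 ha)
    have hcw : ∀ Y : Finset V, 0 ≤ clusterWeight' G Λ θ x Y S := fun Y => clusterWeight'_nonneg θ x Y S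
    by_cases hyS : (some y : Option V) ∈ S <;> by_cases hzS : (some z : Option V) ∈ S <;>
      by_cases hkS : (some k : Option V) ∈ S <;> by_cases hlS : (some l : Option V) ∈ S <;>
      simp only [filter_insert, filter_singleton, hyS, hzS, hkS, hlS, if_true, if_false, card_insert_of_notMem, card_singleton, card_empty, mem_insert, mem_singleton, Nat.even_iff, insert_empty_eq, hyz, hyk, hyl, hzk, hzl, hkl, or_self, or_false, false_or, not_false_eq_true, not_true_eq_false, and_self, and_true, true_and, and_false, false_and, Nat.reduceMod, Nat.reduceAdd, zero_add, ite_true, ite_false, reduceCtorEq] <;>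
      linarith [mul_le_mul_of_nonneg_right Fy (hcw ({x, y} : Finset V)),
        mul_le_mul_of_nonneg_right Fz (hcw ({x, z} : Finset V)),
        mul_le_mul_of_nonneg_right Fk (hcw ({x, k} : Finset V)),
        mul_le_mul_of_nonneg_right Fl (hcw ({x, l} : Finset V)),
        mul_le_mul_of_nonneg_right (hcor hl) (hcw ({x, y, z, k} : Finset V)),
        mul_le_mul_of_nonneg_right (hcor hk) (hcw ({x, y, z, l} : Finset V)),
        mul_le_mul_of_nonneg_right (hcor hz) (hcw ({x, y, k, l} : Finset V)),
        mul_le_mul_of_nonneg_right (hcor hy) (hcw ({x, z, k, l} : Finset V)),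
        mul_nonneg (hcw ({x, y} : Finset V)) (add_nonneg (mul_nonneg (hm hl) (hG hz hk)) (mul_nonneg (hm hk) (hG hz hl))),
        mul_nonneg (hcw ({x, z} : Finset V)) (add_nonneg (mul_nonneg (hm hl) (hG hy hk)) (mul_nonneg (hm hk) (hG hy hl))),
        mul_nonneg (hcw ({x, k} : Finset V)) (add_nonneg (mul_nonneg (hm hz) (hG hl hy)) (mul_nonneg (hm hy) (hG hl hz))),
        mul_nonneg (hcw ({x, l} : Finset V)) (add_nonneg (mul_nonneg (hm hz) (hG hk hy)) (mul_nonneg (hm hy) (hG hk hz))),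
        mul_nonneg (hm hl) (hcw ({x, y, z, k} : Finset V)),
        mul_nonneg (hm hk) (hcw ({x, y, z, l} : Finset V)),
        mul_nonneg (hm hz) (hcw ({x, y, k, l} : Finset V)),
        mul_nonneg (hm hy) (hcw ({x, z, k, l} : Finset V)),
        mul_nonneg hCnn (mul_nonneg (hcor0 hy) (hcw ({x, z} : Finset V))),
        mul_nonneg hCnn (mul_nonneg (hcor0 hz) (hcw ({x, y} : Finset V))),
        mul_nonneg hBnn (mul_nonneg (hcor0 hk) (hcw ({x, l} : Finset V))),
        mul_nonneg hBnn (mul_nonneg (hcor0 hl) (hcw ({x, k} : Finset V))),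
        mul_nonneg (hcor0 hl) (hcw ({x, y, z, k} : Finset V)),
        mul_nonneg (hcor0 hk) (hcw ({x, y, z, l} : Finset V)),
        mul_nonneg (hcor0 hz) (hcw ({x, y, k, l} : Finset V)),
        mul_nonneg (hcor0 hy) (hcw ({x, z, k, l} : Finset V))]
  refine (sum_le_sum hpt).trans ?_
  -- sum the pointwise bound: (3.15) for the pair weights, the `A₂` lemma for the triple weights
  have hpairset : ∀ {a : V}, x ≠ a → ({x, a} : Finset V) = {x} ∆ {a} := fun {a} hxa => (pair hxa).symm
  have hsum1 : ∀ {a : V}, a ∈ Λ → x ≠ a → ∑ S ∈ 𝒯, clusterWeight' G Λ θ x {x, a} S =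
      thetaCorr G Λ θ ({x} ∆ {a}) - thetaCorr G Λ θ {x} * thetaCorr G Λ θ {a} := by
    intro a ha hxa
    rw [hpairset hxa]
    simp only [clusterWeight'_pair]
    exact sum_clusterWeight_filter_eq hθ hx ha
  -- the triple weights
  have hsum3 : ∀ {p q r d : V}, p ∈ Λ → q ∈ Λ → r ∈ Λ → d ∈ Λ → x ≠ p → x ≠ q → x ≠ r → p ≠ q → p ≠ r → q ≠ r →
      ∀ (Y : Finset V), Y = insert x (insert p ({q} ∆ {r})) →
      ∀ (P : Finset (Option V) → Prop) [DecidablePred P],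
        (∀ S, P S → (some q : Option V) ∉ S ∧ (some r : Option V) ∉ S) →
        ∑ S ∈ 𝒯, (if P S then thetaCorr G Λ θ {d} * clusterWeight' G Λ θ x Y S else 0) ≤
          thetaCorr G Λ θ {d} * (thetaCorr G Λ (zeroField θ) ({q} ∆ {r}) *
            (thetaCorr G Λ θ ({x} ∆ {p}) - thetaCorr G Λ θ {x} * thetaCorr G Λ θ {p})) := by
    intro p q r d hp hq hr hd hxp hxq hxr hpq hpr hqr Y hY P _ hP
    rw [← sum_filter, ← mul_sum, hY]
    refine mul_le_mul_of_nonneg_left ?_ (hm hd)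
    refine le_trans ?_ (sum_clusterWeight'_triple_le hθ hx hp hq hr hxp hxq hxr hpq hpr hqr)
    refine sum_le_sum_of_subset_of_nonneg (fun S hS => ?_) fun S _ _ => clusterWeight'_nonneg θ x _ S
    rw [mem_filter] at hS ⊢
    rw [h𝒯, mem_filter] at hS
    obtain ⟨⟨hS1, hS2, hS3⟩, hPS⟩ := hS
    exact ⟨hS1, hS2, hS3, hP S hPS⟩
  have e1 : ({x, y, z, k} : Finset V) = insert x (insert y ({z} ∆ {k})) := by rw [pair hzk]
  have e2 : ({x, y, z, l} : Finset V) = insert x (insert y ({z} ∆ {l})) := by rw [pair hzl]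
  have e3 : ({x, y, k, l} : Finset V) = insert x (insert l ({k} ∆ {y})) := by
    rw [pair hyk.symm]; ext v; simp only [mem_insert, mem_singleton]; tauto
  have e4 : ({x, z, k, l} : Finset V) = insert x (insert l ({k} ∆ {z})) := by
    rw [pair hzk.symm]; ext v; simp only [mem_insert, mem_singleton]; tauto
  have t1 := hsum3 hy hz hk hl hxy hxz hxk hyz hyk hzk _ e1
    (fun S => (some l : Option V) ∈ S ∧ (some y : Option V) ∉ S ∧ (some z : Option V) ∉ S ∧ (some k : Option V) ∉ S)
    (fun S h => ⟨h.2.2.1, h.2.2.2⟩)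
  have t2 := hsum3 hy hz hl hk hxy hxz hxl hyz hyl hzl _ e2
    (fun S => (some k : Option V) ∈ S ∧ (some y : Option V) ∉ S ∧ (some z : Option V) ∉ S ∧ (some l : Option V) ∉ S)
    (fun S h => ⟨h.2.2.1, h.2.2.2⟩)
  have t3 := hsum3 hl hk hy hz hxl hxk hxy hkl.symm hyl.symm hyk.symm _ e3
    (fun S => (some z : Option V) ∈ S ∧ (some y : Option V) ∉ S ∧ (some k : Option V) ∉ S ∧ (some l : Option V) ∉ S)
    (fun S h => ⟨h.2.2.1, h.2.1⟩)
  have t4 := hsum3 hl hk hz hy hxl hxk hxz hkl.symm hzl.symm hzk.symm _ e4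
    (fun S => (some y : Option V) ∈ S ∧ (some z : Option V) ∉ S ∧ (some k : Option V) ∉ S ∧ (some l : Option V) ∉ S)
    (fun S h => ⟨h.2.2.1, h.2.1⟩)
  rw [sum_add_distrib, sum_add_distrib, sum_add_distrib, sum_add_distrib, sum_add_distrib, sum_add_distrib, sum_add_distrib,
    ← sum_mul, ← sum_mul, ← sum_mul, ← sum_mul, hsum1 hy hxy, hsum1 hz hxz, hsum1 hk hxk, hsum1 hl hxl]
  have hτ : ∀ {a : V}, a ∈ Λ → 0 ≤ thetaCorr G Λ θ ({x} ∆ {a}) - thetaCorr G Λ θ {x} * thetaCorr G Λ θ {a} := by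
    intro a ha
    have := thetaCorr_mul_le_symmDiff hθ (singleton_subset_iff.2 hx) (singleton_subset_iff.2 ha) (θ := θ) (G := G)
    linarith
  nlinarith [t1, t2, t3, t4,
    mul_nonneg (hτ hy) (mul_nonneg (hG hz hk) (hm hl)), mul_nonneg (hτ hy) (mul_nonneg (hG hz hl) (hm hk)),
    mul_nonneg (hτ hz) (mul_nonneg (hG hy hk) (hm hl)), mul_nonneg (hτ hz) (mul_nonneg (hG hy hl) (hm hk)),
    mul_nonneg (hτ hk) (mul_nonneg (hG hl hy) (hm hz)), mul_nonneg (hτ hk) (mul_nonneg (hG hl hz) (hm hy)),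
    mul_nonneg (hτ hl) (mul_nonneg (hG hk hy) (hm hz)), mul_nonneg (hτ hl) (mul_nonneg (hG hk hz) (hm hy))]

end Triple

end Literature.Probability.LatticeModels
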